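/-
Copyright (c) 2026 the pub-hodgecm-mathlib formalisation cell (harness21).  Prover seat hodgecm-mathlib-K2E4-p13 (g2), Track B «K2-LIT» ∕ h413, ‹S› ROAD J ∕ R3 «RANK-ONE MASS», brick
R3f∕F3a «THE DOCK CONJUGATOR IS A BLOCK SIMILITUDE» (K2E3-plan (g2) deal (D11) 2026-09-04T01:04:01Z; cut F1–F6, road owner K2E3-p15 (g2) «=» 01:12:33Z).  2026-09-04.
-/
import Literature.NumberTheory.Rogawski1990.LocalEndoscopicCentralDockCM     -- ★ the dock currency: `endoEmbLocal`, `coe_endoGL_eq`, `cmDatum … .Local v`, `conjLocal`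
import Literature.NumberTheory.Automorphic.LocalRegularOrbitClosed          -- ★ `map_conjLocal_transpose_localForm` (the local form is hermitian)
import HarnessLib

/-!
# ‹S› road J ∕ R3f, F3a: an `ι(H_v)`-invariant hermitian form is `endoForm(λΦ₂, μ)` — the dock conjugator `y` of `θ = Ad(y) ∘ ι_v` is a BLOCK SIMILITUDE
# (Rogawski 1990 §4.8 Case (a) p. 53, §8.1 p. 116; Platonov–Rapinchuk 1994 §2.3)

Cell `pub/hodgecm-mathlib`, Track B «K2-LIT», crux H413 = `stmt-HodgeConjecture-24833`; ‹S› ROAD J, letter ‹J3› v2 `sig_K2E3CompatibleMeasureEPIdentityRankOne`, payer road R3 (owner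
K2E3-p15 (g2)); brick R3f «DOCK-SIDE NUMBER», sub-brick **F3a** of this seat's cut (bus 01:07:45Z, «=» 01:12:33Z).  THEOREMS ONLY; lane `--supports stmt-HodgeConjecture-24833 --as helper`.

THE FINDING IT SERVES (bus 01:07:45Z).  ‹J3› v2 quantifies over an arbitrary central dock `θ : H_v ≃ₜ* Z(ε)` with `(θ z) = y · ι_v(z) · y⁻¹` (`hθ`), `y ∈ GL₃(E_v)` arbitrary.  Since
`θ z ∈ U(H′)_v` for every `z ∈ H_v`, the hermitian form **`G := ᵗ(σy)·H′_v·y`** is invariant under `ι_v(H_v)`; this file shows that such a form is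
  **`G = endoForm(λ·Φ₂, μ) = (0 0 λ; 0 μ 0; λ 0 0)`, `σλ = λ`, `σμ = μ`**
— i.e. `y` is a local SIMILITUDE between `H′_v` and the block form `λΦ₂ ⊕ μΦ₁` in print's coordinates `(a 0 b; 0 u 0; c 0 d)`, with INDEPENDENT local scalars on the two blocks.
(F3b∕F3c then rescale `y` by `ι(H_v)`-central block scalars at an inert place to reach a scalar-1 congruence from a GLOBAL block form, so that ★ (W1) `map_finTamagawaPartner_congr_eq`
and ★ F1 `map_blockCentralizerEquiv_prod_finTamagawaPartner` transport `t^ω` along the dock.)  PROOF: two unipotents suffice — for `δ ∈ E_v^×` with `σδ = −δ`,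
`u⁺ = (1 δ; 0 1)`, `u⁻ = (1 0; δ 1)` lie in `U(Φ₂)_v` (`δ + σδ = 0`), `ι(u⁺, 1) = 1 + δE₀₂`, `ι(u⁻, 1) = 1 + δE₂₀`; invariance under `1 + δE₀₂` kills `G₀₀, G₁₀` and forces
`G₂₀ = G₀₂`, invariance under `1 + δE₂₀` kills `G₂₂, G₁₂, G₂₁`; hermitian symmetry does the rest.
* §1 (any commutative ring `K`, `σ : K →+* K`, `δ` a unit with `σδ = −δ`): `entry_eqs_of_upper_invariant`, `entry_eqs_of_lower_invariant`, **`eq_endoForm_of_unipotent_invariant`**.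
* §2 (the CM dock at a finite place `v`): `localForm_two_eq`, `unipotent_mem_local_two` (the two test elements of `U(Φ₂)_v`), `formCongr_invariant_of_conj_mem` (`G` is `ι(z)`-invariant
  whenever `y·ι(z)·y⁻¹ ∈ U(H′)_v`), **`exists_formCongr_dock_eq`** (`∃ λ μ` `σ`-fixed, `ᵗ(σy)·H′_v·y = (0 0 λ; 0 μ 0; λ 0 0)`; stated for any map `θ` into any type `Z` read in `U(H′)_v`
  through `toG`, so that it applies verbatim to ‹J3›'s `θ : H_v ≃ₜ* ↥Z(ε)` with `toG := fun t => t.1`).  (Units: `λ μ` are units since `H′_v` is — not recorded here.)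
HONEST LABEL: HC_CM is proved only modulo the 7 printed citations (2 remaining named inputs: hLiu418 = `stmt-HodgeConjecture-24832`, h413 = `stmt-HodgeConjecture-24833`) until rung 0
closes; unconditional matrix algebra, pays no socket by itself.

## References
* [Rogawski1990] J. D. Rogawski, *Automorphic Representations of Unitary Groups in Three Variables*, Ann. of Math. Stud. 123 (1990), §4.8 Case (a) p. 53 (the embedding `ι`), §8.1
  p. 116 («compatible measures»), §3.8 Prop. 3.8.1 (a) p. 30.
* [PlatonovRapinchuk1994] V. Platonov, A. Rapinchuk, *Algebraic Groups and Number Theory* (1994), §2.3 (similitudes of hermitian forms).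
-/

set_option autoImplicit false
set_option linter.dupNamespace false

noncomputable section

open NumberField IsDedekindDomain Matrix
open Literature.NumberTheory.Automorphic Literature.NumberTheory.Automorphic.UnitaryGroup Literature.NumberTheory.Rogawski1990
open scoped MatrixGroups Matrix

namespace Summit.HodgeConjecture.HodgeConjecture.Cruxes.H413.K2E3DockInvariantForm

/-! ## §1 The `3 × 3` computation over a commutative ring -/

section Algebra

variable {K : Type*} [CommRing K] (σ : K →+* K) {δ : K} (hδ : IsUnit δ) (hσδ : σ δ = -δ) (G : Matrix (Fin 3) (Fin 3) K)

include hδ hσδ in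
/-- Invariance of `G` under `1 + δE₀₂` (`= ι(u⁺, 1)`): `G₀₀ = 0`, `G₁₀ = 0`, `G₂₀ = G₀₂`. [cite: Rogawski1990, §4.8 Case (a) p. 53] -/
theorem entry_eqs_of_upper_invariant
    (h : ((!![1, 0, δ; 0, 1, 0; 0, 0, 1] : Matrix (Fin 3) (Fin 3) K).map σ)ᵀ * G * !![1, 0, δ; 0, 1, 0; 0, 0, 1] = G) :
    G 0 0 = 0 ∧ G 1 0 = 0 ∧ G 2 0 = G 0 2 := by
  have e02 := congrFun (congrFun h 0) 2
  have e12 := congrFun (congrFun h 1) 2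
  have e22 := congrFun (congrFun h 2) 2
  simp only [Matrix.mul_apply, Fin.sum_univ_three, Matrix.transpose_apply, Matrix.map_apply, Matrix.of_apply, Matrix.cons_val', Matrix.cons_val_zero,
    Matrix.cons_val_one, Matrix.cons_val_two, Matrix.empty_val', Matrix.cons_val_fin_one, Matrix.head_cons, Matrix.tail_cons, Matrix.head_fin_const,
    map_one, map_zero, hσδ] at e02 e12 e22
  have h00 : G 0 0 = 0 := by
    have : δ * G 0 0 = 0 := by linear_combination e02
    exact (hδ.mul_right_eq_zero).1 this
  have h10 : G 1 0 = 0 := by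
    have : δ * G 1 0 = 0 := by linear_combination e12
    exact (hδ.mul_right_eq_zero).1 this
  refine ⟨h00, h10, ?_⟩
  have : δ * (G 2 0 - G 0 2) = 0 := by linear_combination e22 + δ * δ * h00
  exact sub_eq_zero.1 ((hδ.mul_right_eq_zero).1 this)

include hδ hσδ in
/-- Invariance of `G` under `1 + δE₂₀` (`= ι(u⁻, 1)`): `G₂₂ = 0`, `G₁₂ = 0`, `G₂₁ = 0`, `G₀₂ = G₂₀`. [cite: Rogawski1990, §4.8 Case (a) p. 53] -/
theorem entry_eqs_of_lower_invariant
    (h : ((!![1, 0, 0; 0, 1, 0; δ, 0, 1] : Matrix (Fin 3) (Fin 3) K).map σ)ᵀ * G * !![1, 0, 0; 0, 1, 0; δ, 0, 1] = G) :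
    G 2 2 = 0 ∧ G 1 2 = 0 ∧ G 2 1 = 0 := by
  have e20 := congrFun (congrFun h 2) 0
  have e10 := congrFun (congrFun h 1) 0
  have e01 := congrFun (congrFun h 0) 1
  have e21 := congrFun (congrFun h 2) 1
  simp only [Matrix.mul_apply, Fin.sum_univ_three, Matrix.transpose_apply, Matrix.map_apply, Matrix.of_apply, Matrix.cons_val', Matrix.cons_val_zero,
    Matrix.cons_val_one, Matrix.cons_val_two, Matrix.empty_val', Matrix.cons_val_fin_one, Matrix.head_cons, Matrix.tail_cons, Matrix.head_fin_const,
    map_one, map_zero, hσδ] at e20 e10 e01 e21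
  have h22 : G 2 2 = 0 := by
    have : δ * G 2 2 = 0 := by linear_combination e20
    exact (hδ.mul_right_eq_zero).1 this
  have h12 : G 1 2 = 0 := by
    have : δ * G 1 2 = 0 := by linear_combination e10
    exact (hδ.mul_right_eq_zero).1 this
  have h21 : G 2 1 = 0 := by
    have : δ * G 2 1 = 0 := by linear_combination -e01
    exact (hδ.mul_right_eq_zero).1 this
  exact ⟨h22, h12, h21⟩

include hδ hσδ in
/-- **AN `ι(H)`-INVARIANT HERMITIAN FORM IS `endoForm(λΦ₂, μ)`**: `G` hermitian (`ᵗ(σG) = G`) and invariant under the two unipotents `1 + δE₀₂ = ι(u⁺, 1)`, `1 + δE₂₀ = ι(u⁻, 1)`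
(`σδ = −δ`, `δ` a unit) is `(0 0 λ; 0 μ 0; λ 0 0)` with `λ = G₀₂`, `μ = G₁₁` BOTH `σ`-FIXED — print's coordinates `(a 0 b; 0 u 0; c 0 d)`: `y` is a similitude of `H′_v` with
`λΦ₂ ⊕ μΦ₁`, independent scalars on the two blocks. [cite: Rogawski1990, §4.8 Case (a) p. 53; §8.1 p. 116] [cite: PlatonovRapinchuk1994, §2.3] -/
theorem eq_endoForm_of_unipotent_invariant (hG : (G.map σ)ᵀ = G)
    (hup : ((!![1, 0, δ; 0, 1, 0; 0, 0, 1] : Matrix (Fin 3) (Fin 3) K).map σ)ᵀ * G * !![1, 0, δ; 0, 1, 0; 0, 0, 1] = G)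
    (hlo : ((!![1, 0, 0; 0, 1, 0; δ, 0, 1] : Matrix (Fin 3) (Fin 3) K).map σ)ᵀ * G * !![1, 0, 0; 0, 1, 0; δ, 0, 1] = G) :
    G = !![0, 0, G 0 2; 0, G 1 1, 0; G 0 2, 0, 0] ∧ σ (G 0 2) = G 0 2 ∧ σ (G 1 1) = G 1 1 := by
  obtain ⟨h00, h10, h20⟩ := entry_eqs_of_upper_invariant σ hδ hσδ G hup
  obtain ⟨h22, h12, h21⟩ := entry_eqs_of_lower_invariant σ hδ hσδ G hlo
  have hs : ∀ i j, σ (G j i) = G i j := fun i j => by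
    have := congrFun (congrFun hG i) j
    rwa [Matrix.transpose_apply, Matrix.map_apply] at this
  have h01 : G 0 1 = 0 := by rw [← hs 0 1, h10, map_zero]
  refine ⟨?_, ?_, ?_⟩
  · ext i j
    fin_cases i <;> fin_cases j
    · exact h00
    · exact h01
    · rfl
    · exact h10
    · rfl
    · exact h12
    · exact h20
    · exact h21
    · exact h22
  · exact (hs 2 0).trans h20
  · exact hs 1 1

end Algebra

/-! ## §2 The CM dock: `ᵗ(σy)·H′_v·y = endoForm(λΦ₂, μ)` for every conjugator `y` of a central dock -/

section Dock

variable (L : Type) [Field L] [NumberField L] [IsCMField L] (H' : Matrix (Fin 3) (Fin 3) L) (v : HeightOneSpectrum (𝓞 ↥(maximalRealSubfield L)))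

omit [IsCMField L] in
/-- The local form of `Φ₂` is `(0 1; 1 0)` (★ `adelicForm_map_adeleToLocal`). [cite: Rogawski1990, §4.8 Case (a) p. 53] -/
theorem localForm_two_eq :
    (adelicForm L 2 (Matrix.of fun i j : Fin 2 => if i.val + j.val + 1 = 2 then (1 : L) else 0)).map (adeleToLocal L v) = !![(0 : LocalRing L v), 1; 1, 0] := by
  rw [adelicForm_map_adeleToLocal]
  ext i j
  fin_cases i <;> fin_cases j <;> simp [Matrix.map_apply]

/-- **A unipotent `u = (1 x; 0 1)` or `(1 0; x 1)` with `x + σx = 0` lies in `U(Φ₂)(L⁺_v)`** (`ᵗ(σu)·Φ₂·u = Φ₂`). [cite: Rogawski1990, §4.8 p. 53] -/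
theorem unipotent_mem_local_two (u : GL (Fin 2) (LocalRing L v)) {x : LocalRing L v} (hx : conjLocal L (IsCMField.complexConj L) v x = -x)
    (hu : u.val = !![1, x; 0, 1] ∨ u.val = !![1, 0; x, 1]) :
    u ∈ «local» L (IsCMField.complexConj L) 2 (Matrix.of fun i j : Fin 2 => if i.val + j.val + 1 = 2 then (1 : L) else 0) v := by
  show u ∈ unitaryGroupOfForm (conjLocal L (IsCMField.complexConj L) v) ((adelicForm L 2 _).map (adeleToLocal L v))
  rw [mem_unitaryGroupOfForm_iff, localForm_two_eq]
  rcases hu with hu | hu <;>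
  · rw [hu]
    ext i j
    fin_cases i <;> fin_cases j <;> simp [Matrix.mul_apply, Fin.sum_univ_two, hx]

/-- **The form `G = ᵗ(σy)·H′_v·y` is invariant under `ι_v(z)` for every `z ∈ H_v` docked by `y`**: if `y·ι_v(z)·y⁻¹ ∈ U(H′)(L⁺_v)` then
`ᵗσ(ι_v z) · G · ι_v z = G`. [cite: Rogawski1990, §4.8 Case (a) p. 53; §8.1 p. 116] [cite: PlatonovRapinchuk1994, §2.3] -/
theorem formCongr_invariant_of_conj_mem (y : GL (Fin 3) (LocalRing L v)) (g : GL (Fin 3) (LocalRing L v))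
    (hmem : y * g * y⁻¹ ∈ «local» L (IsCMField.complexConj L) 3 H' v) :
    (g.val.map (conjLocal L (IsCMField.complexConj L) v))ᵀ *
        formCongr (conjLocal L (IsCMField.complexConj L) v) y ((adelicForm L 3 H').map (adeleToLocal L v)) * g.val =
      formCongr (conjLocal L (IsCMField.complexConj L) v) y ((adelicForm L 3 H').map (adeleToLocal L v)) := by
  set σ := conjLocal L (IsCMField.complexConj L) v with hσdef
  set Hv := (adelicForm L 3 H').map (adeleToLocal L v) with hHv
  set yM : Matrix (Fin 3) (Fin 3) (LocalRing L v) := y.val with hyM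
  set gM : Matrix (Fin 3) (Fin 3) (LocalRing L v) := g.val with hgM
  set yiM : Matrix (Fin 3) (Fin 3) (LocalRing L v) := (y⁻¹).val with hyiM
  have h : ((yM * gM * yiM).map σ)ᵀ * Hv * (yM * gM * yiM) = Hv := by
    have h0 := (mem_unitaryGroupOfForm_iff).1 hmem
    rwa [Units.val_mul, Units.val_mul] at h0
  have e1 : yiM * yM = 1 := by rw [hyiM, hyM, ← Units.val_mul, inv_mul_cancel, Units.val_one]
  have e2 : (yM.map σ)ᵀ * (yiM.map σ)ᵀ = 1 := by
    rw [← Matrix.transpose_mul, ← Matrix.map_mul, e1, Matrix.map_one σ (map_zero σ) (map_one σ), Matrix.transpose_one]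
  -- conjugate the membership identity back by `y`
  have key : (yM.map σ)ᵀ * (((yM * gM * yiM).map σ)ᵀ * Hv * (yM * gM * yiM)) * yM = (yM.map σ)ᵀ * Hv * yM := by rw [h]
  simp only [Matrix.map_mul, Matrix.transpose_mul, Matrix.mul_assoc] at key
  rw [e1, Matrix.mul_one, ← Matrix.mul_assoc ((yM.map σ)ᵀ) ((yiM.map σ)ᵀ), e2, Matrix.one_mul] at key
  rw [formCongr]
  simp only [Matrix.mul_assoc]
  exact key

/-- **F3a — THE DOCK CONJUGATOR IS A BLOCK SIMILITUDE.**  At a finite place `v` of `L⁺`, for a dock `θ` of `H_v = U(Φ₂)_v × U(Φ₁)_v` into `U(H′)_v` conjugating the endoscopic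
embedding by `y ∈ GL₃(E_v)` (`hθ`: `↑(θ z) = y · ι_v(z) · y⁻¹`), the form `ᵗ(σy)·H′_v·y` is `(0 0 λ; 0 μ 0; λ 0 0) = endoForm(λΦ₂, μ)` with `σλ = λ`, `σμ = μ`.  (Test elements: the
unipotents `(u±, 1)`, `u⁺ = (1 δ; 0 1)`, `u⁻ = (1 0; δ 1)`, `δ = ι(δ_L)`, `c δ_L = −δ_L ≠ 0`; ★ `coe_endoGL_eq`.) [cite: Rogawski1990, §4.8 Case (a) p. 53; §8.1 p. 116] [cite: PlatonovRapinchuk1994, §2.3] -/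
theorem exists_formCongr_dock_eq (hherm : (H'.map (cmConjRingHom L))ᵀ = H') {Z : Type*} (θ : ((cmDatum L 2 (Matrix.of fun i j : Fin 2 => if i.val + j.val + 1 = 2 then (1 : L) else 0)).Local v) × ((cmDatum L 1 (Matrix.of fun i j : Fin 1 => if i.val + j.val + 1 = 1 then (1 : L) else 0)).Local v) → Z) (toG : Z → ((cmDatum L 3 H').Local v))
    (y : GL (Fin 3) (LocalRing L v))
    (hθ : ∀ z, (((toG (θ z))).val : GL (Fin 3) (LocalRing L v)) = y * ((endoEmbLocal L v z).val : GL (Fin 3) (LocalRing L v)) * y⁻¹) :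
    ∃ lam mu : LocalRing L v, conjLocal L (IsCMField.complexConj L) v lam = lam ∧ conjLocal L (IsCMField.complexConj L) v mu = mu ∧
      formCongr (conjLocal L (IsCMField.complexConj L) v) y ((adelicForm L 3 H').map (adeleToLocal L v)) = !![0, 0, lam; 0, mu, 0; lam, 0, 0] := by
  haveI : Algebra.IsQuadraticExtension ↥(maximalRealSubfield L) L := IsCMField.isQuadraticExtension L
  -- an anti-fixed non-zero `δ_L ∈ L`; `δ = ι(δ_L)` is a unit of `E_v` with `σδ = −δ`
  obtain ⟨δL, hcδ, hδ0⟩ : ∃ d : L, IsCMField.complexConj L d = -d ∧ d ≠ 0 := by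
    have hne : IsCMField.complexConj L ≠ 1 := IsCMField.complexConj_ne_one (K := L)
    obtain ⟨z, hz⟩ : ∃ z : L, IsCMField.complexConj L z ≠ z := by
      by_contra hall
      exact hne (AlgEquiv.ext fun z => not_not.mp (not_exists.mp hall z))
    refine ⟨z - IsCMField.complexConj L z, ?_, sub_ne_zero.2 (Ne.symm hz)⟩
    rw [map_sub, IsCMField.complexConj_apply_apply, neg_sub]
  set σ := conjLocal L (IsCMField.complexConj L) v with hσdef
  set δ : LocalRing L v := algebraMap L (LocalRing L v) δL with hδdef
  have hσδ : σ δ = -δ := by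
    rw [hδdef, hσdef, conjLocal_algebraMap, hcδ, map_neg]
  have hδu : IsUnit δ := (IsUnit.mk0 δL hδ0).map (algebraMap L (LocalRing L v))
  have hσσ : ∀ x : LocalRing L v, σ (σ x) = x := Liu2021.LemD1OfPlace.conjLocal_conjLocal_apply L v (IsCMField.complexConj L) hcδ hδ0
  set G := formCongr σ y ((adelicForm L 3 H').map (adeleToLocal L v)) with hGdef
  -- `G` is hermitian
  have hHv := map_conjLocal_transpose_localForm L 3 H' v hherm
  have hG : (G.map σ)ᵀ = G := by
    have hPP : (y.val.map σ).map σ = y.val := Matrix.ext fun i j => by simp only [Matrix.map_apply, hσσ]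
    have hPt : ((y.val.map σ)ᵀ).map σ = (y.val)ᵀ := by rw [Matrix.transpose_map, hPP]
    rw [hGdef, formCongr, Matrix.map_mul, Matrix.map_mul, hPt, Matrix.transpose_mul, Matrix.transpose_mul, Matrix.transpose_transpose, hHv, Matrix.mul_assoc]
  -- the two unipotent test elements of `U(Φ₂)_v`
  have hiU : (!![1, δ; 0, 1] : Matrix (Fin 2) (Fin 2) (LocalRing L v)) * !![1, -δ; 0, 1] = 1 := by
    ext i j; fin_cases i <;> fin_cases j <;> simp [Matrix.mul_apply, Fin.sum_univ_two]
  have hiU' : (!![1, -δ; 0, 1] : Matrix (Fin 2) (Fin 2) (LocalRing L v)) * !![1, δ; 0, 1] = 1 := by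
    ext i j; fin_cases i <;> fin_cases j <;> simp [Matrix.mul_apply, Fin.sum_univ_two]
  have hiL : (!![1, 0; δ, 1] : Matrix (Fin 2) (Fin 2) (LocalRing L v)) * !![1, 0; -δ, 1] = 1 := by
    ext i j; fin_cases i <;> fin_cases j <;> simp [Matrix.mul_apply, Fin.sum_univ_two]
  have hiL' : (!![1, 0; -δ, 1] : Matrix (Fin 2) (Fin 2) (LocalRing L v)) * !![1, 0; δ, 1] = 1 := by
    ext i j; fin_cases i <;> fin_cases j <;> simp [Matrix.mul_apply, Fin.sum_univ_two]
  let uU : GL (Fin 2) (LocalRing L v) := ⟨!![1, δ; 0, 1], !![1, -δ; 0, 1], hiU, hiU'⟩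
  let uL : GL (Fin 2) (LocalRing L v) := ⟨!![1, 0; δ, 1], !![1, 0; -δ, 1], hiL, hiL'⟩
  have huU := unipotent_mem_local_two L v uU hσδ (Or.inl rfl)
  have huL := unipotent_mem_local_two L v uL hσδ (Or.inr rfl)
  let zU : ((cmDatum L 2 (Matrix.of fun i j : Fin 2 => if i.val + j.val + 1 = 2 then (1 : L) else 0)).Local v) × ((cmDatum L 1 (Matrix.of fun i j : Fin 1 => if i.val + j.val + 1 = 1 then (1 : L) else 0)).Local v) := (⟨uU, huU⟩, 1)
  let zL : ((cmDatum L 2 (Matrix.of fun i j : Fin 2 => if i.val + j.val + 1 = 2 then (1 : L) else 0)).Local v) × ((cmDatum L 1 (Matrix.of fun i j : Fin 1 => if i.val + j.val + 1 = 1 then (1 : L) else 0)).Local v) := (⟨uL, huL⟩, 1)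
  -- invariance of `G` under `ι(z±)`
  have hmU : y * ((endoEmbLocal L v zU).val : GL (Fin 3) (LocalRing L v)) * y⁻¹ ∈ «local» L (IsCMField.complexConj L) 3 H' v := by
    rw [← hθ zU]; exact (toG (θ zU)).2
  have hmL : y * ((endoEmbLocal L v zL).val : GL (Fin 3) (LocalRing L v)) * y⁻¹ ∈ «local» L (IsCMField.complexConj L) 3 H' v := by
    rw [← hθ zL]; exact (toG (θ zL)).2
  have hinvU := formCongr_invariant_of_conj_mem L H' v y _ hmU
  have hinvL := formCongr_invariant_of_conj_mem L H' v y _ hmL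
  have hmatU : (((endoEmbLocal L v zU).val : GL (Fin 3) (LocalRing L v))).val = !![1, 0, δ; 0, 1, 0; 0, 0, 1] := by
    rw [coe_endoEmbLocal, coe_endoGL_eq]
    ext i j; fin_cases i <;> fin_cases j <;> rfl
  have hmatL : (((endoEmbLocal L v zL).val : GL (Fin 3) (LocalRing L v))).val = !![1, 0, 0; 0, 1, 0; δ, 0, 1] := by
    rw [coe_endoEmbLocal, coe_endoGL_eq]
    ext i j; fin_cases i <;> fin_cases j <;> rfl
  rw [hmatU] at hinvU
  rw [hmatL] at hinvL
  obtain ⟨hGeq, hlam, hmu⟩ := eq_endoForm_of_unipotent_invariant σ hδu hσδ G hG hinvU hinvL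
  exact ⟨G 0 2, G 1 1, hlam, hmu, hGeq⟩

end Dock

end Summit.HodgeConjecture.HodgeConjecture.Cruxes.H413.K2E3DockInvariantForm

end
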